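import Mathlib
import Summits.KontsevichZagierPeriods.KontsevichZagierPeriods.Theorems.ScissorsTransportPolytopeTransportLinAffine

/-!
# Polytope transport — rational simplices

Helper file for `PolytopeTransport` (stmt-KontsevichZagierPeriods-10815, route ScissorsTransport).
For a rational simplex `convexHull ℝ (range v)` (affinely independent `v` with rational
coordinates) in `ℝⁿ⁺¹` we record: it lies in a rational box containing its vertices; if it is not
full-dimensional it is a null set (it lies in a proper affine subspace); if it is full-dimensional,
its barycentric coordinates are RATIONAL affine functions `bary j : LinQ (n + 1)` and the simplex
is `{x | ∀ j, 0 ≤ bary j x}` (Mathlib's `AffineBasis.convexHull_eq_nonneg_coord` for the real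
affine basis, whose coordinates agree with the real extensions of the coordinates of the rational
affine basis). Folklore linear algebra.
-/

noncomputable section

open Set MeasureTheory
open scoped BigOperators

namespace Summit.KontsevichZagierPeriods.ScissorsTransport.PolytopeTransport

variable {n : ℕ}

/-! ### Boxes -/

/-- The rational box is convex. [folklore] -/
theorem convex_cbox (n : ℕ) (R : ℚ) : Convex ℝ (cbox n R) := by
  have : cbox n R = Set.pi univ fun _ => Ioo (-(R : ℝ)) R := by
    ext x; simp [cbox]
  rw [this]
  exact convex_pi fun _ _ => convex_Ioo _ _

/-- A simplex whose vertices lie in the open box lies in the box. [folklore] -/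
theorem convexHull_subset_cbox {k m : ℕ} {v : Fin (k + 1) → (Fin m → ℝ)} {R : ℚ}
    (h : ∀ a b, -(R : ℝ) < v a b ∧ v a b < R) : convexHull ℝ (range v) ⊆ cbox m R :=
  convexHull_min (by rintro _ ⟨a, rfl⟩; exact fun b => h a b) (convex_cbox m R)

/-! ### Lower-dimensional simplices are null -/

/-- A simplex in `ℝⁿ⁺¹` spanned by `k + 1 ≠ n + 2` affinely independent points is a null set.
[folklore] -/
theorem volume_convexHull_eq_zero_of_ne {k : ℕ} {v : Fin (k + 1) → (Fin (n + 1) → ℝ)}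
    (hv : AffineIndependent ℝ v) (hk : k ≠ n + 1) : volume (convexHull ℝ (range v)) = 0 := by
  have hne : affineSpan ℝ (range v) ≠ ⊤ := by
    intro htop
    have := (hv.affineSpan_eq_top_iff_card_eq_finrank_add_one).1 htop
    simp only [Fintype.card_fin, Module.finrank_fin_fun] at this
    omega
  exact measure_mono_null (convexHull_subset_affineSpan _)
    (Measure.addHaar_affineSubspace volume _ hne)

/-! ### Rational barycentric coordinates of a full-dimensional rational simplex -/

/-- The componentwise cast `ℚⁿ⁺¹ → ℝⁿ⁺¹` as a `ℚ`-linear map. [folklore] -/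
def castL (m : ℕ) : (Fin m → ℚ) →ₗ[ℚ] (Fin m → ℝ) :=
  LinearMap.pi fun i => (Algebra.linearMap ℚ ℝ).comp (LinearMap.proj i)

/-- `castL` is the componentwise cast. [folklore] -/
@[simp] theorem castL_apply {m : ℕ} (q : Fin m → ℚ) (b : Fin m) : castL m q b = (q b : ℝ) := by
  simp [castL]

/-- **Rational barycentric coordinates.** A full-dimensional simplex with rational vertices is cut
out by the non-negativity of finitely many rational affine functions (its barycentric
coordinates). [folklore] -/
theorem exists_bary {k : ℕ} (hk : k = n + 1) (v : Fin (k + 1) → (Fin (n + 1) → ℝ))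
    (hv : AffineIndependent ℝ v) (hrat : ∀ a b, ∃ q : ℚ, v a b = (q : ℝ)) :
    ∃ bary : Fin (k + 1) → LinQ (n + 1), ∀ x, x ∈ convexHull ℝ (range v) ↔ ∀ j, 0 ≤ (bary j).ev x := by
  classical
  subst hk
  choose w hw using hrat
  -- `v` is the cast of the rational family `w`
  have hvw : (castL (n + 1)).toAffineMap ∘ (fun a => w a) = v := by
    funext a; ext b; simp [hw]
  -- rational affine independence and the rational affine basis
  have hvQ : AffineIndependent ℚ v := by
    rw [affineIndependent_iff_linearIndependent_vsub ℚ v 0]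
    exact ((affineIndependent_iff_linearIndependent_vsub ℝ v 0).1 hv).restrict_scalars' ℚ
  have hwind : AffineIndependent ℚ (fun a => w a) :=
    AffineIndependent.of_comp (castL (n + 1)).toAffineMap (hvw ▸ hvQ)
  have hwspan : affineSpan ℚ (range fun a => w a) = ⊤ := by
    rw [hwind.affineSpan_eq_top_iff_card_eq_finrank_add_one]
    simp
  set B : AffineBasis (Fin (n + 1 + 1)) ℚ (Fin (n + 1) → ℚ) := ⟨fun a => w a, hwind, hwspan⟩ with hB
  have hBw : ∀ j, B j = w j := fun j => rfl
  -- the real affine basis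
  have hvspan : affineSpan ℝ (range v) = ⊤ := by
    rw [hv.affineSpan_eq_top_iff_card_eq_finrank_add_one]
    simp
  set Bℝ : AffineBasis (Fin (n + 1 + 1)) ℝ (Fin (n + 1) → ℝ) := ⟨v, hv, hvspan⟩ with hBℝ
  have hBℝv : ∀ j, Bℝ j = v j := fun j => rfl
  -- the rational barycentric functionals
  obtain ⟨e, he⟩ : ∃ e : Fin (n + 1 + 1) → ℚ, ∀ j, e j = B.coord j 0 := ⟨_, fun _ => rfl⟩
  obtain ⟨c, hc⟩ : ∃ c : Fin (n + 1 + 1) → Fin (n + 1) → ℚ,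
      ∀ j i, c j i = B.coord j (Pi.single i 1) - e j := ⟨_, fun _ _ => rfl⟩
  refine ⟨fun j => (c j, e j), fun x => ?_⟩
  have hev : ∀ j, LinQ.ev (c j, e j) x = ∑ i, (c j i : ℝ) * x i + e j := fun j => rfl
  -- rational identities from the rational basis
  have hcomb : ∀ (q : Fin (n + 1) → ℚ) (b : Fin (n + 1)), ∑ j, B.coord j q * w j b = q b := by
    intro q b
    have := congrFun (B.linear_combination_coord_eq_self q) b
    simpa [Finset.sum_apply, hBw] using this
  have hsum_e : ∑ j, (e j : ℝ) = 1 := by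
    have h0 := B.sum_coord_apply_eq_one (0 : Fin (n + 1) → ℚ)
    have : ∑ j, e j = 1 := by simpa only [he] using h0
    exact_mod_cast this
  have hsum_c : ∀ i, ∑ j, (c j i : ℝ) = 0 := by
    intro i
    have h1 := B.sum_coord_apply_eq_one (Pi.single i (1 : ℚ) : Fin (n + 1) → ℚ)
    have h0 := B.sum_coord_apply_eq_one (0 : Fin (n + 1) → ℚ)
    have : ∑ j, c j i = 0 := by
      simp only [hc, he, Finset.sum_sub_distrib, h1, h0, sub_self]
    exact_mod_cast this
  have hsum_ev : ∀ b, ∑ j, (e j : ℝ) * v j b = 0 := by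
    intro b
    have h0 : ∑ j, e j * w j b = 0 := by
      have := hcomb 0 b
      simpa only [he, Pi.zero_apply] using this
    have := congrArg (fun t : ℚ => (t : ℝ)) h0
    push_cast at this
    simpa only [hw] using this
  have hsum_cv : ∀ i b, ∑ j, (c j i : ℝ) * v j b = if i = b then 1 else 0 := by
    intro i b
    have h1 : ∑ j, B.coord j (Pi.single i 1) * w j b = (Pi.single i (1 : ℚ) : Fin (n + 1) → ℚ) b :=
      hcomb _ b
    have h0 : ∑ j, e j * w j b = 0 := by
      have := hcomb 0 b
      simpa only [he, Pi.zero_apply] using this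
    have hq : ∑ j, c j i * w j b = (Pi.single i (1 : ℚ) : Fin (n + 1) → ℚ) b := by
      have hsplit : ∑ j, c j i * w j b = ∑ j, B.coord j (Pi.single i 1) * w j b - ∑ j, e j * w j b := by
        simp only [hc, sub_mul, Finset.sum_sub_distrib]
      rw [hsplit, h1, h0, sub_zero]
    by_cases hib : i = b
    · subst hib
      rw [Pi.single_eq_same] at hq
      have := congrArg (fun t : ℚ => (t : ℝ)) hq
      push_cast at this
      simpa only [hw, if_true] using this
    · rw [Pi.single_eq_of_ne (Ne.symm hib)] at hq
      have := congrArg (fun t : ℚ => (t : ℝ)) hq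
      push_cast at this
      simpa only [hw, hib, if_false] using this
  -- the real coordinates are the rational functionals
  have hA : ∑ j, LinQ.ev (c j, e j) x = 1 := by
    simp only [hev, Finset.sum_add_distrib, hsum_e]
    rw [Finset.sum_comm]
    simp only [← Finset.sum_mul, hsum_c, zero_mul, Finset.sum_const_zero, zero_add]
  have hBx : ∑ j, LinQ.ev (c j, e j) x • v j = x := by
    ext b
    simp only [Finset.sum_apply, Pi.smul_apply, smul_eq_mul, hev, add_mul, Finset.sum_add_distrib,
      hsum_ev, add_zero, Finset.sum_mul]
    rw [Finset.sum_comm]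
    have : ∀ i, ∑ j, (c j i : ℝ) * x i * v j b = x i * ∑ j, (c j i : ℝ) * v j b := by
      intro i
      rw [Finset.mul_sum]
      refine Finset.sum_congr rfl fun j _ => by ring
    simp only [this, hsum_cv, mul_ite, mul_one, mul_zero]
    rw [Finset.sum_ite_eq']
    simp
  have hkey : ∀ j, Bℝ.coord j x = LinQ.ev (c j, e j) x := by
    intro j
    have hx : x = Finset.affineCombination ℝ Finset.univ Bℝ (fun j => LinQ.ev (c j, e j) x) := by
      rw [Finset.affineCombination_eq_linear_combination _ _ _ hA]
      simp only [hBℝv]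
      exact hBx.symm
    conv_lhs => rw [hx]
    exact Bℝ.coord_apply_combination_of_mem (Finset.mem_univ j) hA
  have hcoe : (⇑Bℝ : Fin (n + 1 + 1) → (Fin (n + 1) → ℝ)) = v := rfl
  rw [← hcoe, Bℝ.convexHull_eq_nonneg_coord]
  simp only [mem_setOf_eq, hkey]

end Summit.KontsevichZagierPeriods.ScissorsTransport.PolytopeTransport
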